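import Mathlib.NumberTheory.DirichletCharacter.Orthogonality
import Mathlib.RingTheory.RootsOfUnity.AlgebraicallyClosed
import Mathlib.Analysis.Complex.Polynomial.Basic
import Mathlib.Data.ZMod.Units
import HarnessLib

/-!
# Local analysis of Dirichlet characters for the structure of Hodge characters (Aoki 1983, §§3–6, re-derived)

Support file II (everything PROVED; no named facts, no definitions) for the structure theorem of
the Hodge characters of the Fermat surface (`AokiShioda1983_thmB2m_standard`). Aoki's criterion
(file `FermatHodgeCharacterCriterion`, `IsHodge.aoki_criterion`) turns the Hodge condition into
the vanishing of short character sums `∑ n_g χ(g)` for all ODD PRIMITIVE characters `χ` of a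
level `f`. To exploit it one varies the `p`-component of `χ` for a prime power `p^e ∥ f`; this
file supplies the two tools:

* **Products of characters at coprime levels** (`q`, `n` coprime): the character
  `χ₁ ⊠ χ₂ := (χ₁ ∘ mod q) · (χ₂ ∘ mod n)` of level `q n` has `(χ₁ ⊠ χ₂)(x) = χ₁(x mod q) χ₂(x mod n)`
  (`prodChar_apply`), parity the product of the parities, and is PRIMITIVE when `χ₁`, `χ₂` are
  (`prodChar_isPrimitive`; via `DirichletCharacter.factorsThrough_iff_ker_unitsMap` and CRT lifts
  of units, `exists_unit_crt`).
* **Local Fourier lemma on `(ℤ/q)ˣ`** (`sum_parityPart_eq_of_orthogonal`): if `F : ℤ/q → ℂ` is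
  orthogonal to every character `χ` mod `q` of parity `ε` that does NOT factor through a given
  `d ∣ q`, then the parity-`ε` part of `F` is invariant on units under the kernel of
  `(ℤ/q)ˣ → (ℤ/d)ˣ`: `F(ux) + ε F(-ux) = F(x) + ε F(-x)` for units `x` and `u ≡ 1 (mod d)`
  (character orthogonality `DirichletCharacter.sum_char_inv_mul_char_eq`).

These replace, for our purposes, the group-ring "normalized expansions" of [Aoki1983, §§3–4]
(Lemmas 4.3–4.5, Cor. 3.4, Prop. 6.3).

## References

* [Aoki1983] N. Aoki, On some arithmetic problems related to the Hodge cycles on the Fermat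
  varieties, Math. Ann. 266 (1983) 23–54, §§3–6 (text read).
-/

noncomputable section

open Finset

namespace Literature.AlgebraicGeometry.HodgeTheory

namespace FermatCharacter

/-! ### Units of `ℤ/(qn)` for coprime `q`, `n` -/

/-- For coprime `q, n`: `x` is a unit mod `qn` iff it is a unit mod `q` and mod `n`. [folklore] -/
theorem isUnit_iff_of_coprime {q n : ℕ} [NeZero q] [NeZero n] (x : ZMod (q * n)) :
    IsUnit x ↔ IsUnit (ZMod.castHom (dvd_mul_right q n) (ZMod q) x) ∧
      IsUnit (ZMod.castHom (dvd_mul_left n q) (ZMod n) x) := by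
  haveI : NeZero (q * n) := ⟨mul_ne_zero (NeZero.ne q) (NeZero.ne n)⟩
  conv_lhs => rw [← ZMod.natCast_zmod_val x]
  conv_rhs => rw [← ZMod.natCast_zmod_val x]
  rw [ZMod.isUnit_iff_coprime, map_natCast, map_natCast, ZMod.isUnit_iff_coprime,
    ZMod.isUnit_iff_coprime]
  exact Nat.coprime_mul_iff_right

/-- The first CRT component is reduction mod `q` (cf. the identical lemma in
`Literature.NumberTheory.Sieve`, not imported here to keep the import graph light). [folklore] -/
private theorem chineseRemainder_fst {q n : ℕ} (h : q.Coprime n) (x : ZMod (q * n)) :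
    (ZMod.chineseRemainder h x).1 = ZMod.castHom (dvd_mul_right q n) (ZMod q) x := by
  change ((ZMod.cast x : ZMod q × ZMod n)).1 = _
  rw [Prod.fst_zmod_cast, ZMod.castHom_apply]

/-- The second CRT component is reduction mod `n` (cf. `Literature.NumberTheory.Sieve`).
[folklore] -/
private theorem chineseRemainder_snd {q n : ℕ} (h : q.Coprime n) (x : ZMod (q * n)) :
    (ZMod.chineseRemainder h x).2 = ZMod.castHom (dvd_mul_left n q) (ZMod n) x := by
  change ((ZMod.cast x : ZMod q × ZMod n)).2 = _
  rw [Prod.snd_zmod_cast, ZMod.castHom_apply]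

/-- **CRT for units**: for coprime `q, n` and units `a` mod `q`, `b` mod `n` there is a unit `k`
mod `qn` reducing to `a` and to `b`. [folklore] -/
theorem exists_unit_crt {q n : ℕ} [NeZero q] [NeZero n] (h : q.Coprime n) (a : (ZMod q)ˣ)
    (b : (ZMod n)ˣ) :
    ∃ k : (ZMod (q * n))ˣ, ZMod.unitsMap (dvd_mul_right q n) k = a ∧
      ZMod.unitsMap (dvd_mul_left n q) k = b := by
  set e := ZMod.chineseRemainder h with he
  set x : ZMod (q * n) := e.symm ((a : ZMod q), (b : ZMod n)) with hx
  have hex : e x = ((a : ZMod q), (b : ZMod n)) := by rw [hx, RingEquiv.apply_symm_apply]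
  have hxu : IsUnit x := by
    have hu : IsUnit (((a : ZMod q), (b : ZMod n)) : ZMod q × ZMod n) :=
      Prod.isUnit_iff.mpr ⟨Units.isUnit a, Units.isUnit b⟩
    simpa [hx] using hu.map e.symm
  refine ⟨hxu.unit, ?_, ?_⟩
  · ext
    rw [ZMod.unitsMap_val, IsUnit.unit_spec, ← ZMod.castHom_apply (h := dvd_mul_right q n),
      ← chineseRemainder_fst h, ← he, hex]
  · ext
    rw [ZMod.unitsMap_val, IsUnit.unit_spec, ← ZMod.castHom_apply (h := dvd_mul_left n q),
      ← chineseRemainder_snd h, ← he, hex]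

/-- **CRT injectivity**: for coprime `q, n`, an element of `ℤ/(qn)` is determined by its
reductions mod `q` and mod `n`. [folklore] -/
theorem eq_of_cast_eq_of_coprime {q n : ℕ} (h : q.Coprime n) {x y : ZMod (q * n)}
    (h1 : ZMod.castHom (dvd_mul_right q n) (ZMod q) x = ZMod.castHom (dvd_mul_right q n) (ZMod q) y)
    (h2 : ZMod.castHom (dvd_mul_left n q) (ZMod n) x = ZMod.castHom (dvd_mul_left n q) (ZMod n) y) :
    x = y := by
  apply (ZMod.chineseRemainder h).injective
  exact Prod.ext (by rw [chineseRemainder_fst, chineseRemainder_fst, h1])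
    (by rw [chineseRemainder_snd, chineseRemainder_snd, h2])

/-- Casts compose: reducing mod `q` and then mod `c ∣ q` is reducing mod `c`. [folklore] -/
theorem castHom_castHom {m q c : ℕ} (hq : q ∣ m) (hc : c ∣ q) (x : ZMod m) :
    ZMod.castHom hc (ZMod c) (ZMod.castHom hq (ZMod q) x) = ZMod.castHom (hc.trans hq) (ZMod c) x := by
  have : (ZMod.castHom hc (ZMod c)).comp (ZMod.castHom hq (ZMod q)) =
      ZMod.castHom (hc.trans hq) (ZMod c) := RingHom.ext_zmod _ _
  rw [← this, RingHom.comp_apply]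

/-- The value of `unitsMap` as an element of `ZMod`. [folklore] -/
theorem coe_unitsMap {m d : ℕ} (hd : d ∣ m) (k : (ZMod m)ˣ) :
    ((ZMod.unitsMap hd k : (ZMod d)ˣ) : ZMod d) = ZMod.castHom hd (ZMod d) (k : ZMod m) := by
  rw [ZMod.unitsMap_val, ZMod.castHom_apply]

/-! ### Products of characters at coprime levels -/

section Prod

variable {q n : ℕ} [NeZero q] [NeZero n]

/-- **Evaluation of the product character**: for coprime `q, n`,
`((χ₁ ∘ mod q)·(χ₂ ∘ mod n))(x) = χ₁(x mod q) χ₂(x mod n)` for every `x ∈ ℤ/(qn)`. [folklore] -/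
theorem prodChar_apply (χ₁ : DirichletCharacter ℂ q) (χ₂ : DirichletCharacter ℂ n)
    (x : ZMod (q * n)) :
    (DirichletCharacter.changeLevel (dvd_mul_right q n) χ₁ *
        DirichletCharacter.changeLevel (dvd_mul_left n q) χ₂) x =
      χ₁ (ZMod.castHom (dvd_mul_right q n) (ZMod q) x) *
        χ₂ (ZMod.castHom (dvd_mul_left n q) (ZMod n) x) := by
  haveI : NeZero (q * n) := ⟨mul_ne_zero (NeZero.ne q) (NeZero.ne n)⟩
  rw [MulChar.mul_apply]
  by_cases hx : IsUnit x
  · rw [← hx.unit_spec, DirichletCharacter.changeLevel_eq_cast_of_dvd χ₁ _ hx.unit,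
      DirichletCharacter.changeLevel_eq_cast_of_dvd χ₂ _ hx.unit, ZMod.castHom_apply,
      ZMod.castHom_apply]
  · obtain h1 | h2 := not_and_or.mp ((isUnit_iff_of_coprime x).not.mp hx)
    · rw [MulChar.map_nonunit _ hx, MulChar.map_nonunit _ h1, zero_mul, zero_mul]
    · rw [MulChar.map_nonunit _ hx, MulChar.map_nonunit _ h2, zero_mul, mul_zero]

/-- The product character at `-1`. [folklore] -/
theorem prodChar_neg_one (χ₁ : DirichletCharacter ℂ q)
    (χ₂ : DirichletCharacter ℂ n) :
    (DirichletCharacter.changeLevel (dvd_mul_right q n) χ₁ *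
        DirichletCharacter.changeLevel (dvd_mul_left n q) χ₂) (-1) = χ₁ (-1) * χ₂ (-1) := by
  have e1 : ZMod.castHom (dvd_mul_right q n) (ZMod q) (-1) = -1 := by
    rw [map_neg (ZMod.castHom (dvd_mul_right q n) (ZMod q)), map_one]
  have e2 : ZMod.castHom (dvd_mul_left n q) (ZMod n) (-1) = -1 := by
    rw [map_neg (ZMod.castHom (dvd_mul_left n q) (ZMod n)), map_one]
  rw [prodChar_apply, e1, e2]

/-- Odd times even is odd. [folklore] -/
theorem prodChar_odd_of_odd_even {χ₁ : DirichletCharacter ℂ q}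
    {χ₂ : DirichletCharacter ℂ n} (h1 : χ₁.Odd) (h2 : χ₂.Even) :
    (DirichletCharacter.changeLevel (dvd_mul_right q n) χ₁ *
        DirichletCharacter.changeLevel (dvd_mul_left n q) χ₂).Odd := by
  rw [DirichletCharacter.Odd, prodChar_neg_one, h1, h2]
  ring

/-- Even times odd is odd. [folklore] -/
theorem prodChar_odd_of_even_odd {χ₁ : DirichletCharacter ℂ q}
    {χ₂ : DirichletCharacter ℂ n} (h1 : χ₁.Even) (h2 : χ₂.Odd) :
    (DirichletCharacter.changeLevel (dvd_mul_right q n) χ₁ *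
        DirichletCharacter.changeLevel (dvd_mul_left n q) χ₂).Odd := by
  rw [DirichletCharacter.Odd, prodChar_neg_one, h1, h2]
  ring

/-- Odd times odd is even. [folklore] -/
theorem prodChar_even_of_odd_odd {χ₁ : DirichletCharacter ℂ q}
    {χ₂ : DirichletCharacter ℂ n} (h1 : χ₁.Odd) (h2 : χ₂.Odd) :
    (DirichletCharacter.changeLevel (dvd_mul_right q n) χ₁ *
        DirichletCharacter.changeLevel (dvd_mul_left n q) χ₂).Even := by
  rw [DirichletCharacter.Even, prodChar_neg_one, h1, h2]
  ring

/-- Even times even is even. [folklore] -/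
theorem prodChar_even_of_even_even {χ₁ : DirichletCharacter ℂ q}
    {χ₂ : DirichletCharacter ℂ n} (h1 : χ₁.Even) (h2 : χ₂.Even) :
    (DirichletCharacter.changeLevel (dvd_mul_right q n) χ₁ *
        DirichletCharacter.changeLevel (dvd_mul_left n q) χ₂).Even := by
  rw [DirichletCharacter.Even, prodChar_neg_one, h1, h2]
  ring

/-- **The first factor of a product character factoring through `c·n` (`c ∣ q`) factors through
`c`**: test `χ₁` on `k ∈ ker((ℤ/q)ˣ → (ℤ/c)ˣ)` by lifting `(k, 1)` to a unit of `ℤ/(qn)`, which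
reduces to `1` mod `cn`. [folklore] -/
theorem factorsThrough_left_of_prodChar (h : q.Coprime n) (χ₁ : DirichletCharacter ℂ q)
    (χ₂ : DirichletCharacter ℂ n) {c : ℕ} (hc : c ∣ q)
    (hfac : (DirichletCharacter.changeLevel (dvd_mul_right q n) χ₁ *
        DirichletCharacter.changeLevel (dvd_mul_left n q) χ₂).FactorsThrough (c * n)) :
    χ₁.FactorsThrough c := by
  haveI : NeZero (q * n) := ⟨mul_ne_zero (NeZero.ne q) (NeZero.ne n)⟩
  have hcn : c * n ∣ q * n := mul_dvd_mul_right hc n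
  have hc0 : c ≠ 0 := fun h0 ↦ NeZero.ne q (zero_dvd_iff.mp (h0 ▸ hc))
  haveI : NeZero c := ⟨hc0⟩
  haveI : NeZero (c * n) := ⟨mul_ne_zero hc0 (NeZero.ne n)⟩
  have hcop' : c.Coprime n := Nat.Coprime.coprime_dvd_left hc h
  rw [DirichletCharacter.factorsThrough_iff_ker_unitsMap hcn] at hfac
  rw [DirichletCharacter.factorsThrough_iff_ker_unitsMap hc]
  intro k hk
  rw [MonoidHom.mem_ker] at hk ⊢
  obtain ⟨K, hK1, hK2⟩ := exists_unit_crt h k 1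
  have hk' : ZMod.castHom hc (ZMod c) (k : ZMod q) = 1 := by
    rw [← coe_unitsMap hc k, hk, Units.val_one]
  have hK1' : ZMod.castHom (dvd_mul_right q n) (ZMod q) (K : ZMod (q * n)) = k := by
    rw [← coe_unitsMap (dvd_mul_right q n) K, hK1]
  have hK2' : ZMod.castHom (dvd_mul_left n q) (ZMod n) (K : ZMod (q * n)) = 1 := by
    rw [← coe_unitsMap (dvd_mul_left n q) K, hK2, Units.val_one]
  -- `K ≡ 1 (mod c n)`
  have hKer : ZMod.unitsMap hcn K = 1 := by
    ext
    rw [coe_unitsMap hcn K, Units.val_one]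
    refine eq_of_cast_eq_of_coprime hcop' ?_ ?_
    · rw [castHom_castHom hcn (dvd_mul_right c n), map_one,
        ← castHom_castHom (dvd_mul_right q n) hc (K : ZMod (q * n)), hK1', hk']
    · rw [castHom_castHom hcn (dvd_mul_left n c), map_one]
      have : ZMod.castHom ((dvd_mul_left n c).trans hcn) (ZMod n) (K : ZMod (q * n)) =
          ZMod.castHom (dvd_mul_left n q) (ZMod n) (K : ZMod (q * n)) := rfl
      rw [this, hK2']
  have hχK := hfac hKer
  rw [MonoidHom.mem_ker] at hχK
  have hval : ((DirichletCharacter.changeLevel (dvd_mul_right q n) χ₁ *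
      DirichletCharacter.changeLevel (dvd_mul_left n q) χ₂).toUnitHom K : ℂ) = χ₁ k := by
    rw [MulChar.coe_toUnitHom, prodChar_apply, hK1', hK2', map_one, mul_one]
  ext
  rw [MulChar.coe_toUnitHom, Units.val_one, ← hval, hχK, Units.val_one]

/-- **The second factor of a product character factoring through `q·c` (`c ∣ n`) factors through
`c`** (the same argument with `(1, k)`). [folklore] -/
theorem factorsThrough_right_of_prodChar (h : q.Coprime n) (χ₁ : DirichletCharacter ℂ q)
    (χ₂ : DirichletCharacter ℂ n) {c : ℕ} (hc : c ∣ n)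
    (hfac : (DirichletCharacter.changeLevel (dvd_mul_right q n) χ₁ *
        DirichletCharacter.changeLevel (dvd_mul_left n q) χ₂).FactorsThrough (q * c)) :
    χ₂.FactorsThrough c := by
  haveI : NeZero (q * n) := ⟨mul_ne_zero (NeZero.ne q) (NeZero.ne n)⟩
  have hcn : q * c ∣ q * n := mul_dvd_mul_left q hc
  have hc0 : c ≠ 0 := fun h0 ↦ NeZero.ne n (zero_dvd_iff.mp (h0 ▸ hc))
  haveI : NeZero c := ⟨hc0⟩
  haveI : NeZero (q * c) := ⟨mul_ne_zero (NeZero.ne q) hc0⟩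
  have hcop' : q.Coprime c := Nat.Coprime.coprime_dvd_right hc h
  rw [DirichletCharacter.factorsThrough_iff_ker_unitsMap hcn] at hfac
  rw [DirichletCharacter.factorsThrough_iff_ker_unitsMap hc]
  intro k hk
  rw [MonoidHom.mem_ker] at hk ⊢
  obtain ⟨K, hK1, hK2⟩ := exists_unit_crt h 1 k
  have hk' : ZMod.castHom hc (ZMod c) (k : ZMod n) = 1 := by
    rw [← coe_unitsMap hc k, hk, Units.val_one]
  have hK1' : ZMod.castHom (dvd_mul_right q n) (ZMod q) (K : ZMod (q * n)) = 1 := by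
    rw [← coe_unitsMap (dvd_mul_right q n) K, hK1, Units.val_one]
  have hK2' : ZMod.castHom (dvd_mul_left n q) (ZMod n) (K : ZMod (q * n)) = k := by
    rw [← coe_unitsMap (dvd_mul_left n q) K, hK2]
  have hKer : ZMod.unitsMap hcn K = 1 := by
    ext
    rw [coe_unitsMap hcn K, Units.val_one]
    refine eq_of_cast_eq_of_coprime hcop' ?_ ?_
    · rw [castHom_castHom hcn (dvd_mul_right q c), map_one]
      have : ZMod.castHom ((dvd_mul_right q c).trans hcn) (ZMod q) (K : ZMod (q * n)) =
          ZMod.castHom (dvd_mul_right q n) (ZMod q) (K : ZMod (q * n)) := rfl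
      rw [this, hK1']
    · rw [castHom_castHom hcn (dvd_mul_left c q), map_one,
        ← castHom_castHom (dvd_mul_left n q) hc (K : ZMod (q * n)), hK2', hk']
  have hχK := hfac hKer
  rw [MonoidHom.mem_ker] at hχK
  have hval : ((DirichletCharacter.changeLevel (dvd_mul_right q n) χ₁ *
      DirichletCharacter.changeLevel (dvd_mul_left n q) χ₂).toUnitHom K : ℂ) = χ₂ k := by
    rw [MulChar.coe_toUnitHom, prodChar_apply, hK1', hK2', map_one, one_mul]
  ext
  rw [MulChar.coe_toUnitHom, Units.val_one, ← hval, hχK, Units.val_one]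

/-- **Products of primitive characters at coprime levels are primitive**: the conductor `c` of the
product splits as `gcd(c,q)·gcd(c,n)`; the product factors through `gcd(c,q)·n` and `q·gcd(c,n)`,
so `χ₁`, `χ₂` factor through `gcd(c,q)`, `gcd(c,n)`, which by primitivity are `q`, `n`. [folklore] -/
theorem prodChar_isPrimitive (h : q.Coprime n) {χ₁ : DirichletCharacter ℂ q}
    {χ₂ : DirichletCharacter ℂ n} (h1 : χ₁.IsPrimitive) (h2 : χ₂.IsPrimitive) :
    (DirichletCharacter.changeLevel (dvd_mul_right q n) χ₁ *
        DirichletCharacter.changeLevel (dvd_mul_left n q) χ₂).IsPrimitive := by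
  haveI : NeZero (q * n) := ⟨mul_ne_zero (NeZero.ne q) (NeZero.ne n)⟩
  set χ := DirichletCharacter.changeLevel (dvd_mul_right q n) χ₁ *
    DirichletCharacter.changeLevel (dvd_mul_left n q) χ₂ with hχ
  rw [DirichletCharacter.isPrimitive_def]
  have hcdvd : χ.conductor ∣ q * n := χ.conductor_dvd_level
  have hc_eq : χ.conductor = Nat.gcd χ.conductor q * Nat.gcd χ.conductor n := by
    rw [← Nat.Coprime.gcd_mul _ h, Nat.gcd_eq_left hcdvd]
  have hcq_dvd : Nat.gcd χ.conductor q ∣ q := Nat.gcd_dvd_right _ _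
  have hcn_dvd : Nat.gcd χ.conductor n ∣ n := Nat.gcd_dvd_right _ _
  have hfac : χ.FactorsThrough χ.conductor := χ.factorsThrough_conductor
  have hd1 : χ.conductor ∣ Nat.gcd χ.conductor q * n := by
    conv_lhs => rw [hc_eq]
    exact mul_dvd_mul_left _ hcn_dvd
  have hd2 : χ.conductor ∣ q * Nat.gcd χ.conductor n := by
    conv_lhs => rw [hc_eq]
    exact mul_dvd_mul_right hcq_dvd _
  have hfac1 : χ.FactorsThrough (Nat.gcd χ.conductor q * n) :=
    DirichletCharacter.FactorsThrough.mono χ hfac hd1 (mul_dvd_mul_right hcq_dvd n)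
  have hfac2 : χ.FactorsThrough (q * Nat.gcd χ.conductor n) :=
    DirichletCharacter.FactorsThrough.mono χ hfac hd2 (mul_dvd_mul_left q hcn_dvd)
  have hq : q ∣ Nat.gcd χ.conductor q := by
    have := DirichletCharacter.conductor_dvd_of_mem_conductorSet χ₁
      ((DirichletCharacter.mem_conductorSet_iff _).mpr
        (factorsThrough_left_of_prodChar h χ₁ χ₂ hcq_dvd hfac1))
    rwa [(DirichletCharacter.isPrimitive_def _).mp h1] at this
  have hn : n ∣ Nat.gcd χ.conductor n := by
    have := DirichletCharacter.conductor_dvd_of_mem_conductorSet χ₂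
      ((DirichletCharacter.mem_conductorSet_iff _).mpr
        (factorsThrough_right_of_prodChar h χ₁ χ₂ hcn_dvd hfac2))
    rwa [(DirichletCharacter.isPrimitive_def _).mp h2] at this
  exact dvd_antisymm hcdvd (hc_eq ▸ mul_dvd_mul hq hn)

end Prod


/-! ### The local Fourier lemma on `(ℤ/q)ˣ` -/

/-- A character takes the values `±1` at `-1`. [folklore] -/
theorem char_neg_one_eq_or {q : ℕ} (χ : DirichletCharacter ℂ q) : χ (-1) = 1 ∨ χ (-1) = -1 := by
  have hsq : χ (-1) * χ (-1) = 1 := by rw [← map_mul, neg_one_mul, neg_neg, map_one]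
  exact mul_self_eq_one_iff.mp hsq

/-- Twisting a character sum by `x ↦ -x` multiplies it by `χ(-1)`. [folklore] -/
theorem sum_neg_mul_char {q : ℕ} [NeZero q] (F : ZMod q → ℂ) (χ : DirichletCharacter ℂ q) :
    ∑ x : ZMod q, F (-x) * χ x = χ (-1) * ∑ x : ZMod q, F x * χ x := by
  rw [← Equiv.sum_comp (Equiv.neg (ZMod q)), Finset.mul_sum]
  refine sum_congr rfl fun x _ ↦ ?_
  simp only [Equiv.neg_apply, neg_neg]
  rw [show χ (-x) = χ (-1) * χ x by rw [← map_mul, neg_one_mul]]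
  ring

/-- **Fourier inversion on `(ℤ/q)ˣ`** in the form `φ(q) G(w) = ∑_χ χ(w⁻¹) ⟨G, χ⟩` for a unit `w`.
[folklore] -/
theorem totient_mul_apply_eq_sum_char {q : ℕ} [NeZero q] (G : ZMod q → ℂ) (w : (ZMod q)ˣ) :
    (q.totient : ℂ) * G w =
      ∑ χ : DirichletCharacter ℂ q, χ (w : ZMod q)⁻¹ * ∑ x : ZMod q, G x * χ x := by
  classical
  calc (q.totient : ℂ) * G w
      = ∑ x : ZMod q, (if (w : ZMod q) = x then (q.totient : ℂ) else 0) * G x := by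
        symm
        simp only [ite_mul, zero_mul, Finset.sum_ite_eq, Finset.mem_univ, if_true]
    _ = ∑ x : ZMod q, (∑ χ : DirichletCharacter ℂ q, χ (w : ZMod q)⁻¹ * χ x) * G x := by
        refine sum_congr rfl fun x _ ↦ ?_
        rw [DirichletCharacter.sum_char_inv_mul_char_eq ℂ (Units.isUnit w) x]
    _ = ∑ χ : DirichletCharacter ℂ q, χ (w : ZMod q)⁻¹ * ∑ x : ZMod q, G x * χ x := by
        simp_rw [Finset.sum_mul, Finset.mul_sum]
        rw [Finset.sum_comm]
        refine sum_congr rfl fun χ _ ↦ sum_congr rfl fun x _ ↦ ?_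
        ring

/-- **Local Fourier lemma.** Let `F : ℤ/q → ℂ` be orthogonal to every character `χ` mod `q` of
parity `ε ∈ {±1}` (`χ(-1) = ε`) that does NOT factor through `d ∣ q`. Then the parity-`ε` part
`G(x) = F(x) + ε F(-x)` is, on units, invariant under the kernel of `(ℤ/q)ˣ → (ℤ/d)ˣ`:
`G(uy) = G(y)` for `u ≡ 1 (mod d)`. (The Fourier coefficient `⟨G, χ⟩ = (1 + ε χ(-1)) ⟨F, χ⟩`
vanishes unless `χ` has parity `ε` and factors through `d`, and such `χ` do not see `u`.)
This is the engine behind [Aoki1983, Lemma 4.4 / Prop. 6.3 / Cor. 3.4]. [folklore] -/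
theorem parityPart_mul_eq_of_orthogonal {q d : ℕ} [NeZero q] (hd : d ∣ q) (F : ZMod q → ℂ)
    {ε : ℂ} (hε : ε = 1 ∨ ε = -1)
    (horth : ∀ χ : DirichletCharacter ℂ q, χ (-1) = ε → ¬ χ.FactorsThrough d →
      ∑ x : ZMod q, F x * χ x = 0)
    (u y : (ZMod q)ˣ) (hu : ZMod.unitsMap hd u = 1) :
    F ((u : ZMod q) * y) + ε * F (-((u : ZMod q) * y)) = F y + ε * F (-(y : ZMod q)) := by
  classical
  set G : ZMod q → ℂ := fun x ↦ F x + ε * F (-x) with hG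
  -- Fourier coefficients of `G`
  have hcoef : ∀ χ : DirichletCharacter ℂ q,
      ∑ x : ZMod q, G x * χ x = (1 + ε * χ (-1)) * ∑ x : ZMod q, F x * χ x := by
    intro χ
    have h1 : ∑ x : ZMod q, G x * χ x =
        ∑ x : ZMod q, F x * χ x + ε * ∑ x : ZMod q, F (-x) * χ x := by
      rw [Finset.mul_sum, ← sum_add_distrib]
      refine sum_congr rfl fun x _ ↦ ?_
      simp only [hG]
      ring
    rw [h1, sum_neg_mul_char F χ]
    ring
  have hvan : ∀ χ : DirichletCharacter ℂ q, ¬ (χ (-1) = ε ∧ χ.FactorsThrough d) →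
      ∑ x : ZMod q, G x * χ x = 0 := by
    intro χ hχ
    rw [hcoef χ]
    by_cases hpar : χ (-1) = ε
    · rw [horth χ hpar (fun hft ↦ hχ ⟨hpar, hft⟩), mul_zero]
    · have hne : χ (-1) = -ε := by
        rcases char_neg_one_eq_or χ with h1 | h1 <;> rcases hε with rfl | rfl
        · exact absurd h1 hpar
        · rw [h1, neg_neg]
        · rw [h1]
        · exact absurd h1 hpar
      rw [hne]
      rcases hε with rfl | rfl <;> ring
  -- characters that factor through `d` do not see `u`
  have hsee : ∀ χ : DirichletCharacter ℂ q, χ.FactorsThrough d → χ (u : ZMod q) = 1 := by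
    intro χ hχ
    have hk := (DirichletCharacter.factorsThrough_iff_ker_unitsMap hd).mp hχ
      ((MonoidHom.mem_ker).mpr hu)
    rw [MonoidHom.mem_ker] at hk
    have := congrArg (fun z : ℂˣ ↦ (z : ℂ)) hk
    simpa [MulChar.coe_toUnitHom] using this
  -- compare the two Fourier expansions termwise
  have key : (q.totient : ℂ) * G ((u * y : (ZMod q)ˣ) : ZMod q) = (q.totient : ℂ) * G y := by
    rw [totient_mul_apply_eq_sum_char G (u * y), totient_mul_apply_eq_sum_char G y]
    refine sum_congr rfl fun χ _ ↦ ?_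
    by_cases hs : χ (-1) = ε ∧ χ.FactorsThrough d
    · congr 1
      rw [ZMod.inv_coe_unit, ZMod.inv_coe_unit, mul_inv, Units.val_mul, map_mul]
      have hu1 : χ ((u⁻¹ : (ZMod q)ˣ) : ZMod q) = 1 := by
        have h1 : χ ((u⁻¹ : (ZMod q)ˣ) : ZMod q) * χ (u : ZMod q) = 1 := by
          rw [← map_mul, Units.inv_mul, map_one]
        rw [hsee χ hs.2, mul_one] at h1
        exact h1
      rw [hu1, one_mul]
    · rw [hvan χ hs, mul_zero, mul_zero]
  have hφ : (q.totient : ℂ) ≠ 0 := by exact_mod_cast (Nat.totient_pos.mpr (NeZero.pos q)).ne'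
  have := mul_left_cancel₀ hφ key
  simpa [hG, Units.val_mul] using this


/-! ### Every character of `ℤ/(qn)` is a product -/

section Decomp

variable {q n : ℕ} [NeZero q] [NeZero n]

omit [NeZero q] [NeZero n] in
/-- If the first factor is induced from level `c ∣ q`, the product factors through `c n`.
[folklore] -/
theorem prodChar_factorsThrough_left {c : ℕ} (hc : c ∣ q) (ψ : DirichletCharacter ℂ c)
    (χ₂ : DirichletCharacter ℂ n) :
    (DirichletCharacter.changeLevel (dvd_mul_right q n) (DirichletCharacter.changeLevel hc ψ) *
        DirichletCharacter.changeLevel (dvd_mul_left n q) χ₂).FactorsThrough (c * n) := by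
  refine ⟨mul_dvd_mul_right hc n,
    DirichletCharacter.changeLevel (dvd_mul_right c n) ψ *
      DirichletCharacter.changeLevel (dvd_mul_left n c) χ₂, ?_⟩
  rw [map_mul, ← DirichletCharacter.changeLevel_trans, ← DirichletCharacter.changeLevel_trans,
    ← DirichletCharacter.changeLevel_trans]

omit [NeZero q] [NeZero n] in
/-- If the second factor is induced from level `c ∣ n`, the product factors through `q c`.
[folklore] -/
theorem prodChar_factorsThrough_right {c : ℕ} (hc : c ∣ n) (χ₁ : DirichletCharacter ℂ q)
    (ψ : DirichletCharacter ℂ c) :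
    (DirichletCharacter.changeLevel (dvd_mul_right q n) χ₁ *
        DirichletCharacter.changeLevel (dvd_mul_left n q) (DirichletCharacter.changeLevel hc ψ)).FactorsThrough (q * c) := by
  refine ⟨mul_dvd_mul_left q hc,
    DirichletCharacter.changeLevel (dvd_mul_right q c) χ₁ *
      DirichletCharacter.changeLevel (dvd_mul_left c q) ψ, ?_⟩
  rw [map_mul, ← DirichletCharacter.changeLevel_trans, ← DirichletCharacter.changeLevel_trans,
    ← DirichletCharacter.changeLevel_trans]

/-- **Decomposition of characters along a coprime factorisation.** Every Dirichlet character `χ`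
mod `qn` (`q, n` coprime) is a product `(χ₁ ∘ mod q)·(χ₂ ∘ mod n)` with `χ₁(a) = χ(crt(a,1))`,
`χ₂(b) = χ(crt(1,b))`; if `χ` is primitive, so are `χ₁` and `χ₂`. [folklore] -/
theorem exists_eq_prodChar (h : q.Coprime n) (χ : DirichletCharacter ℂ (q * n)) :
    ∃ (χ₁ : DirichletCharacter ℂ q) (χ₂ : DirichletCharacter ℂ n),
      χ = DirichletCharacter.changeLevel (dvd_mul_right q n) χ₁ *
        DirichletCharacter.changeLevel (dvd_mul_left n q) χ₂ ∧
      (χ.IsPrimitive → χ₁.IsPrimitive ∧ χ₂.IsPrimitive) := by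
  classical
  haveI : NeZero (q * n) := ⟨mul_ne_zero (NeZero.ne q) (NeZero.ne n)⟩
  set e := ZMod.chineseRemainder h with he
  -- the two partial characters
  let χ₁ : DirichletCharacter ℂ q :=
    { toFun := fun a ↦ χ (e.symm (a, 1))
      map_one' := by
        change χ (e.symm (1, 1)) = 1
        rw [show ((1 : ZMod q), (1 : ZMod n)) = (1 : ZMod q × ZMod n) from rfl, map_one, map_one]
      map_mul' := by
        intro a b
        change χ (e.symm (a * b, 1)) = χ (e.symm (a, 1)) * χ (e.symm (b, 1))
        rw [← map_mul, ← map_mul, Prod.mk_mul_mk, mul_one]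
      map_nonunit' := by
        intro a ha
        change χ (e.symm (a, 1)) = 0
        apply MulChar.map_nonunit
        intro hu
        apply ha
        have := hu.map e
        rw [RingEquiv.apply_symm_apply] at this
        exact (Prod.isUnit_iff.mp this).1 }
  let χ₂ : DirichletCharacter ℂ n :=
    { toFun := fun b ↦ χ (e.symm (1, b))
      map_one' := by
        change χ (e.symm (1, 1)) = 1
        rw [show ((1 : ZMod q), (1 : ZMod n)) = (1 : ZMod q × ZMod n) from rfl, map_one, map_one]
      map_mul' := by
        intro a b
        change χ (e.symm (1, a * b)) = χ (e.symm (1, a)) * χ (e.symm (1, b))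
        rw [← map_mul, ← map_mul, Prod.mk_mul_mk, mul_one]
      map_nonunit' := by
        intro b hb
        change χ (e.symm (1, b)) = 0
        apply MulChar.map_nonunit
        intro hu
        apply hb
        have := hu.map e
        rw [RingEquiv.apply_symm_apply] at this
        exact (Prod.isUnit_iff.mp this).2 }
  have hχ₁ : ∀ a : ZMod q, χ₁ a = χ (e.symm (a, 1)) := fun a ↦ rfl
  have hχ₂ : ∀ b : ZMod n, χ₂ b = χ (e.symm (1, b)) := fun b ↦ rfl
  -- the product is `χ`
  have hprod : χ = DirichletCharacter.changeLevel (dvd_mul_right q n) χ₁ *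
      DirichletCharacter.changeLevel (dvd_mul_left n q) χ₂ := by
    apply MulChar.ext'
    intro x
    rw [prodChar_apply, hχ₁, hχ₂, ← map_mul, ← map_mul, Prod.mk_mul_mk, mul_one, one_mul,
      ← chineseRemainder_fst h x, ← chineseRemainder_snd h x, ← he, Prod.mk.eta,
      RingEquiv.symm_apply_apply]
  refine ⟨χ₁, χ₂, hprod, fun hprim ↦ ⟨?_, ?_⟩⟩
  · -- if `χ₁` factors through `c ∣ q`, `c < q`, then `χ` factors through `c n < q n`
    by_contra h1
    have hc : χ₁.conductor ∣ q := χ₁.conductor_dvd_level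
    have hne : χ₁.conductor ≠ q := h1
    obtain ⟨hcd, ψ, hψ⟩ := χ₁.factorsThrough_conductor
    have hfac : χ.FactorsThrough (χ₁.conductor * n) := by
      have key := prodChar_factorsThrough_left (n := n) hcd ψ χ₂
      rw [← hψ, ← hprod] at key
      exact key
    have hdvd := DirichletCharacter.conductor_dvd_of_mem_conductorSet χ
      ((DirichletCharacter.mem_conductorSet_iff _).mpr hfac)
    rw [(DirichletCharacter.isPrimitive_def _).mp hprim] at hdvd
    have hqn : q ∣ χ₁.conductor := by
      have := Nat.dvd_of_mul_dvd_mul_right (NeZero.pos n) hdvd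
      exact this
    exact hne (dvd_antisymm hc hqn)
  · by_contra h2
    have hc : χ₂.conductor ∣ n := χ₂.conductor_dvd_level
    have hne : χ₂.conductor ≠ n := h2
    obtain ⟨hcd, ψ, hψ⟩ := χ₂.factorsThrough_conductor
    have hfac : χ.FactorsThrough (q * χ₂.conductor) := by
      have key := prodChar_factorsThrough_right (q := q) hcd χ₁ ψ
      rw [← hψ, ← hprod] at key
      exact key
    have hdvd := DirichletCharacter.conductor_dvd_of_mem_conductorSet χ
      ((DirichletCharacter.mem_conductorSet_iff _).mpr hfac)
    rw [(DirichletCharacter.isPrimitive_def _).mp hprim] at hdvd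
    have hqn : n ∣ χ₂.conductor := Nat.dvd_of_mul_dvd_mul_left (NeZero.pos q) hdvd
    exact hne (dvd_antisymm hc hqn)

/-- The parities of the factors of an ODD product: one factor is odd and the other even.
[folklore] -/
theorem parities_of_prodChar_odd {χ₁ : DirichletCharacter ℂ q} {χ₂ : DirichletCharacter ℂ n}
    (hodd : (DirichletCharacter.changeLevel (dvd_mul_right q n) χ₁ *
        DirichletCharacter.changeLevel (dvd_mul_left n q) χ₂).Odd) :
    (χ₁.Odd ∧ χ₂.Even) ∨ (χ₁.Even ∧ χ₂.Odd) := by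
  rw [DirichletCharacter.Odd, prodChar_neg_one] at hodd
  rcases char_neg_one_eq_or χ₁ with h1 | h1 <;> rcases char_neg_one_eq_or χ₂ with h2 | h2
  · rw [h1, h2] at hodd; norm_num at hodd
  · exact Or.inr ⟨h1, h2⟩
  · exact Or.inl ⟨h1, h2⟩
  · rw [h1, h2] at hodd; norm_num at hodd

end Decomp

end FermatCharacter

end Literature.AlgebraicGeometry.HodgeTheory
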